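import Summits.ValiantsHypothesis.ValiantsHypothesis.Theorems.LacunarySymmetroidMatrixDescartesStubNegRoots
import Summits.ValiantsHypothesis.ValiantsHypothesis.Theorems.LacunarySymmetroidMatrixDescartesStubPerturbGeneric
import Summits.ValiantsHypothesis.ValiantsHypothesis.Theorems.LacunarySymmetroidMatrixDescartesStubSplit
import Summits.ValiantsHypothesis.ValiantsHypothesis.Theses.LacunarySymmetroid

/-!
# Crux `MatrixDescartes` — line `sign-split` (exponent splitting to the semidefinite class +
the bilinear sign-word Descartes rule)

Strategist line (planner-cstrat-stmt-ValiantsHypothesis-18050-0, 2026-08-17), registered ALONGSIDE the lead's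
line `Lift`; it does not touch `Lines/Lift.lean`.

## Idea
Descartes' rule bounds the positive roots of a scalar lacunary polynomial by the number `V` of SIGN CHANGES of
its coefficients, independently of the number of terms.  For a symmetric lacunary pencil
`F(t) = Σ_l t^{d_l} S_l` the coefficient "signs" are matrices; the line makes them honest signs in two moves:

* **splitting** (`stub_split`): write `S_l = S_l⁺ − S_l⁻` with `S_l^± ⪰ 0` and replace `t^{d_l}(S_l⁺ − S_l⁻)` by
  `u^{N d_l} S_l⁺ − u^{N d_l + 1} S_l⁻` (`u^N = t`).  As `N → ∞`, `F_N(t^{1/N}) → F(t)` locally uniformly on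
  `(0,∞)`, so every strict sign alternation of `det F` survives in `det F_N`: the pencil `F_N` has POSITIVE
  SEMIDEFINITE coefficients up to sign, pairwise DISTINCT exponents, the SAME size `m`, at most `2K` terms, and
  at least as many positive roots as `det F` has sign alternations;
* **perturbation** (`stub_perturb`): roots of `det F` of even multiplicity are recovered as sign changes of
  `det (F ± ε X^{d_{l₀}} E)` for a generic positive definite `E` (local analysis of the kernel jets), so the
  number of DISTINCT positive roots is at most twice the best alternation bound for the format.

In the semidefinite class with distinct exponents the Descartes datum is the sign word `σ : Fin K' → Bool` and
its number of sign changes `V`.  The rule `V ≤ 1 ⇒ Z₊ ≤ m` is a theorem (Loewner monotonicity of `t^{-e}F(t)`,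
negative index jumps at every singular point; it even tolerates an indefinite coefficient at the pivot exponent —
line card §First rung).  The hard stub is the **bilinear semidefinite matrix Descartes rule** (`stub_bmd`):
`Z₊ ≤ 2^{a (log₂ m + 1)(log₂ (V+1) + 1)}` — bilinear in `(log m, log V)`, the shape on which all three known
extremal families sit (Carstensen–Mulmuley–Shah bumps: `log Z = Θ(log m · log K)`; Vinnikov `K = 3`: `Z ~ m²`;
`m = 2`: `Z ~ K²/2`), strictly between the refuted polynomial law and the quasi-polynomial law `MatrixDescartesQP`.
With `V + 1 ≤ 2K` after splitting, `log₂ Z = O(polylog K)` at `log₂ m = polylog K`, which is far inside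
`o(K log K)`: the composition below is the arithmetic of `Cruxes/MatrixDescartes/StrategySketch.lean`
(`matrixDescartes_of_qp`, re-proved here in the needed form).

Stubs (sorries live ONLY here): `stub_negRoots` (S/M, bookkeeping `t ↦ −t`), `stub_perturb` (L),
`stub_split` (M), `stub_bmd` (the open rule).  `MatrixDescartes_of` concludes the crux BY NAME.
-/

set_option linter.dupNamespace false
set_option linter.unusedVariables false

namespace Summit.ValiantsHypothesis.ValiantsHypothesis.Cruxes.MatrixDescartes.SignSplit

open Polynomial Matrix Finset Filter Topology
open scoped BigOperators

/-! ## Vocabulary -/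

/-- The lacunary pencil `Σ_l X^{d_l} • S_l` (verbatim the crux's expression). -/
noncomputable def pencil {K m : ℕ} (d : Fin K → ℕ) (S : Fin K → Matrix (Fin m) (Fin m) ℝ) :
    Matrix (Fin m) (Fin m) ℝ[X] :=
  ∑ l, (X : ℝ[X]) ^ d l • (S l).map C

/-- Number of distinct real roots of `det` of the pencil (the crux's `Z`). -/
noncomputable def rootCount {K m : ℕ} (d : Fin K → ℕ) (S : Fin K → Matrix (Fin m) (Fin m) ℝ) : ℕ :=
  (pencil d S).det.roots.toFinset.card

/-- Number of distinct POSITIVE real roots of `det` of the pencil (`Z₊`). -/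
noncomputable def posRootCount {K m : ℕ} (d : Fin K → ℕ) (S : Fin K → Matrix (Fin m) (Fin m) ℝ) : ℕ :=
  ((pencil d S).det.roots.toFinset.filter (fun t => 0 < t)).card

/-- The pencil with `t ↦ −t` substituted: `S_l ↦ (−1)^{d_l} S_l` (same format). -/
noncomputable def negPencilCoeff {K m : ℕ} (d : Fin K → ℕ) (S : Fin K → Matrix (Fin m) (Fin m) ℝ) :
    Fin K → Matrix (Fin m) (Fin m) ℝ :=
  fun l => ((-1 : ℝ) ^ d l) • S l

/-- Strict sign alternation of `det` of the pencil along positive test points `τ 0 < ⋯ < τ N`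
(the alternation datum of the tree lemma `le_card_posRoots_of_alternating`). -/
def Alternates {K m : ℕ} (d : Fin K → ℕ) (S : Fin K → Matrix (Fin m) (Fin m) ℝ)
    (N : ℕ) (τ : Fin (N + 1) → ℝ) : Prop :=
  StrictMono τ ∧ (∀ j, 0 < τ j) ∧
    ∀ j : Fin N, (pencil d S).det.eval (τ j.castSucc) * (pencil d S).det.eval (τ j.succ) < 0

/-- A signed family of matrices: `σ_l = true ↦ +A_l`, `false ↦ −A_l`. -/
noncomputable def signed {K m : ℕ} (σ : Fin K → Bool) (A : Fin K → Matrix (Fin m) (Fin m) ℝ) :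
    Fin K → Matrix (Fin m) (Fin m) ℝ :=
  fun l => (if σ l then (1 : ℝ) else -1) • A l

/-- Number of sign changes `V` of a sign word read in index order (= exponent order when the exponents
are strictly increasing): positions `i < K - 1` with `σ i ≠ σ (i+1)`. -/
noncomputable def signChanges {K : ℕ} (σ : Fin K → Bool) : ℕ :=
  (Finset.univ.filter fun i : Fin (K - 1) =>
    σ ⟨i.val, lt_of_lt_of_le i.isLt (Nat.sub_le K 1)⟩ ≠ σ ⟨i.val + 1, Nat.add_lt_of_lt_sub i.isLt⟩).card

theorem signChanges_le {K : ℕ} (σ : Fin K → Bool) : signChanges σ ≤ K - 1 := by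
  unfold signChanges
  exact (Finset.card_le_univ _).trans_eq (Fintype.card_fin _)

/-! ## The four stub statements -/

/-- (bookkeeping) all real roots = positive roots + positive roots of the `t ↦ −t` pencil + possibly `0`. -/
def NegRoots : Prop :=
  ∀ (K m : ℕ) (d : Fin K → ℕ) (S : Fin K → Matrix (Fin m) (Fin m) ℝ),
    rootCount d S ≤ posRootCount d S + posRootCount d (negPencilCoeff d S) + 1

/-- (perturbation lemma) if every SYMMETRIC pencil of the format `(d, m)` has at most `B` strict sign
alternations, then every symmetric pencil of that format has at most `2B` distinct positive roots
(roots of even multiplicity become sign changes of `det (F ± ε X^{d l₀} E)`, `E ≻ 0` generic). -/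
def PerturbToAlternation : Prop :=
  ∀ (K m : ℕ) (d : Fin K → ℕ) (B : ℕ),
    (∀ S : Fin K → Matrix (Fin m) (Fin m) ℝ, (∀ l, (S l).IsSymm) →
        ∀ (N : ℕ) (τ : Fin (N + 1) → ℝ), Alternates d S N τ → N ≤ B) →
    ∀ S : Fin K → Matrix (Fin m) (Fin m) ℝ, (∀ l, (S l).IsSymm) → posRootCount d S ≤ 2 * B

/-- (exponent splitting) `N` strict sign alternations of a symmetric pencil of format `(d, m)` force `N`
distinct positive roots of SOME pencil of the same size `m` with at most `2K` terms, pairwise distinct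
exponents and coefficients `± A_l`, `A_l ⪰ 0` (limit `F_N(t^{1/N}) → F(t)` + IVT). -/
def SplitToSemidefinite : Prop :=
  ∀ (K m : ℕ) (d : Fin K → ℕ) (S : Fin K → Matrix (Fin m) (Fin m) ℝ), (∀ l, (S l).IsSymm) →
    ∀ (N : ℕ) (τ : Fin (N + 1) → ℝ), Alternates d S N τ →
      ∃ (K' : ℕ) (d' : Fin K' → ℕ) (σ : Fin K' → Bool) (A : Fin K' → Matrix (Fin m) (Fin m) ℝ),
        K' ≤ 2 * K ∧ StrictMono d' ∧ (∀ l, (A l).PosSemidef) ∧ N ≤ posRootCount d' (signed σ A)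

/-- **C⁺ = the bilinear semidefinite matrix Descartes rule (BMD).**  For PSD `A_l`, strictly increasing
exponents and a sign word `σ` with `V` sign changes, `Z₊(det Σ_l ± X^{d_l} A_l) ≤ 2^{a (log₂ m + 1)(log₂(V+1) + 1)}`.
Rungs: `V = 0` trivial, `V = 1` a theorem (`Z₊ ≤ m`, Loewner monotonicity), `V = 2` open. -/
def BilinearSemidefiniteDescartes : Prop :=
  ∃ a : ℕ, ∀ (K m : ℕ) (d : Fin K → ℕ) (σ : Fin K → Bool) (A : Fin K → Matrix (Fin m) (Fin m) ℝ),
    StrictMono d → (∀ l, (A l).PosSemidef) →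
      posRootCount d (signed σ A) ≤ 2 ^ (a * (Nat.log 2 m + 1) * (Nat.log 2 (signChanges σ + 1) + 1))

/-! ## Stubs (sorries live ONLY here) -/

/-- STUB (S/M): root bookkeeping under `X ↦ −X` (`Polynomial.comp`, `RingHom.map_det`). -/
theorem stub_negRoots : NegRoots := by
  -- LANDED (`…StubNegRoots`, `stub_negRoots`, statement unfolded verbatim): by-name citation, δ-unfold (stub-credit wiring val-port-1 g1, val-lit RULING #246 (a))
  exact Summit.ValiantsHypothesis.ValiantsHypothesis.Theorems.LacunarySymmetroidMatrixDescartes.stub_negRoots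

/-- STUB (L): the perturbation lemma (local kernel-jet analysis at each root; generic positive definite
perturbation of one coefficient, both signs). -/
theorem stub_perturb : PerturbToAlternation := by
  -- LANDED (`…StubPerturbGeneric`, `Perturb.perturbToAlternation` = `PerturbToAlternation` unfolded): by-name citation, δ-unfold (stub-credit wiring val-port-1 g1, val-lit RULING #246 (a))
  exact Summit.ValiantsHypothesis.ValiantsHypothesis.Theorems.LacunarySymmetroidMatrixDescartes.Perturb.perturbToAlternation

/-- STUB (M): exponent splitting (spectral decomposition `S = S⁺ − S⁻`, merging equal exponents,
continuity of `det F_N(τ_j^{1/N})` in `N`, tree lemma `le_card_posRoots_of_alternating`). -/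
theorem stub_split : SplitToSemidefinite := by
  -- LANDED (`…StubSplit`, `stub_split` = `SplitToSemidefinite` unfolded): by-name citation, δ-unfold (stub-credit wiring val-port-1 g1, val-lit RULING #246 (a))
  exact Summit.ValiantsHypothesis.ValiantsHypothesis.Theorems.LacunarySymmetroidMatrixDescartes.stub_split

/-- STUB (the hard one): the bilinear semidefinite matrix Descartes rule. -/
theorem stub_bmd : BilinearSemidefiniteDescartes := by
  sorry

/-! ## Glue (proved) -/

/-- Eventually `b·(L+s)^e ≤ 2^L` (polynomial growth in `L` loses to `2^L`). [folklore; proof as in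
`Cruxes/MatrixDescartes/StrategySketch.lean`] -/
theorem eventually_mul_pow_le_two_pow (b s e : ℕ) : ∃ L₀ : ℕ, ∀ L ≥ L₀, b * (L + s) ^ e ≤ 2 ^ L := by
  have hB : (0 : ℝ) < (b : ℝ) * 2 ^ s + 1 := by positivity
  have hε : (0 : ℝ) < 1 / ((b : ℝ) * 2 ^ s + 1) := by positivity
  have h := (tendsto_pow_const_div_const_pow_of_one_lt e (one_lt_two : (1 : ℝ) < 2)).eventually
    (gt_mem_nhds hε)
  obtain ⟨N, hN⟩ := Filter.eventually_atTop.1 h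
  refine ⟨N, fun L hL => ?_⟩
  have h1 := hN (L + s) (by omega)
  have h2p : (0 : ℝ) < (2 : ℝ) ^ (L + s) := by positivity
  rw [div_lt_iff₀ h2p] at h1
  have h3 : ((b : ℝ) * 2 ^ s + 1) * (((L + s : ℕ) : ℝ) ^ e) < (2 : ℝ) ^ (L + s) := by
    have := mul_lt_mul_of_pos_left h1 hB
    calc ((b : ℝ) * 2 ^ s + 1) * (((L + s : ℕ) : ℝ) ^ e)
        < ((b : ℝ) * 2 ^ s + 1) * (1 / ((b : ℝ) * 2 ^ s + 1) * 2 ^ (L + s)) := this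
      _ = (2 : ℝ) ^ (L + s) := by field_simp
  have h4 : ((b : ℝ) * 2 ^ s) * (((L + s : ℕ) : ℝ) ^ e) ≤ (2 : ℝ) ^ s * 2 ^ L := by
    have hnonneg : (0 : ℝ) ≤ ((L + s : ℕ) : ℝ) ^ e := by positivity
    have : ((b : ℝ) * 2 ^ s) * (((L + s : ℕ) : ℝ) ^ e) ≤ ((b : ℝ) * 2 ^ s + 1) * (((L + s : ℕ) : ℝ) ^ e) :=
      by nlinarith
    have h' : (2 : ℝ) ^ (L + s) = 2 ^ s * 2 ^ L := by rw [pow_add, mul_comm]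
    linarith
  have h5 : ((b : ℝ)) * (((L + s : ℕ) : ℝ) ^ e) ≤ 2 ^ L := by
    have h2s : (0 : ℝ) < (2 : ℝ) ^ s := by positivity
    have : (2 : ℝ) ^ s * ((b : ℝ) * (((L + s : ℕ) : ℝ) ^ e)) ≤ 2 ^ s * 2 ^ L := by
      calc (2 : ℝ) ^ s * ((b : ℝ) * (((L + s : ℕ) : ℝ) ^ e))
          = ((b : ℝ) * 2 ^ s) * (((L + s : ℕ) : ℝ) ^ e) := by ring
        _ ≤ 2 ^ s * 2 ^ L := h4
    exact le_of_mul_le_mul_left this h2s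
  exact_mod_cast h5

/-- **The transfer** (proved modulo the four stubs), with the crux UNFOLDED so that the only theorem of
this file whose conclusion is the crux by name is `MatrixDescartes_of`. -/
theorem matrixDescartes_of_stubs (h₁ : NegRoots) (h₂ : PerturbToAlternation)
    (h₃ : SplitToSemidefinite) (h₄ : BilinearSemidefiniteDescartes) :
    ∀ c q : ℕ, 0 < q → ∃ K₀ : ℕ, ∀ K m : ℕ, K₀ ≤ K → m ≤ 2 ^ ((Nat.log 2 K + c) ^ c) →
      ∀ (d : Fin K → ℕ) (S : Fin K → Matrix (Fin m) (Fin m) ℝ), (∀ l, (S l).IsSymm) →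
        (Matrix.det (∑ l, ((Polynomial.X : Polynomial ℝ) ^ d l) • (S l).map Polynomial.C)
          ).roots.toFinset.card ^ q ≤ 2 ^ (K * Nat.log 2 K) := by
  obtain ⟨a, ha⟩ := h₄
  intro c q hq
  obtain ⟨L₀, hL₀⟩ := eventually_mul_pow_le_two_pow (q * (a + 3)) (c + 2) (c + 2)
  refine ⟨2 ^ max L₀ 1, fun K m hK hm d S hS => ?_⟩
  set L := Nat.log 2 K with hL
  -- Step A: a uniform bound on the positive roots of every semidefinite split of this format
  set E : ℕ := a * (Nat.log 2 m + 1) * (L + 2) with hE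
  have hsplitB : ∀ S' : Fin K → Matrix (Fin m) (Fin m) ℝ, (∀ l, (S' l).IsSymm) →
      ∀ (N : ℕ) (τ : Fin (N + 1) → ℝ), Alternates d S' N τ → N ≤ 2 ^ E := by
    intro S' hS' N τ hA
    obtain ⟨K', d', σ, A, hK', hd', hA', hN⟩ := h₃ K m d S' hS' N τ hA
    refine hN.trans ((ha K' m d' σ A hd' hA').trans ?_)
    have hV : signChanges σ ≤ K' - 1 := signChanges_le σ
    have hlog : Nat.log 2 (signChanges σ + 1) ≤ L + 1 := by
      rcases Nat.eq_zero_or_pos K' with hK0 | hKpos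
      · have h0 : signChanges σ = 0 := by omega
        simp [h0]
      · calc Nat.log 2 (signChanges σ + 1) ≤ Nat.log 2 (K * 2) := Nat.log_mono_right (by omega)
          _ = Nat.log 2 K + 1 := Nat.log_mul_base (by norm_num) (by omega)
          _ = L + 1 := by rw [hL]
    have hlog' : Nat.log 2 (signChanges σ + 1) + 1 ≤ L + 2 := by omega
    calc 2 ^ (a * (Nat.log 2 m + 1) * (Nat.log 2 (signChanges σ + 1) + 1))
        ≤ 2 ^ (a * (Nat.log 2 m + 1) * (L + 2)) :=
          Nat.pow_le_pow_right (by norm_num) (Nat.mul_le_mul_left _ hlog')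
      _ = 2 ^ E := by rw [hE]
  -- Step B: positive roots of any symmetric pencil of this format
  have hposB : ∀ S' : Fin K → Matrix (Fin m) (Fin m) ℝ, (∀ l, (S' l).IsSymm) →
      posRootCount d S' ≤ 2 * 2 ^ E := fun S' hS' => h₂ K m d (2 ^ E) hsplitB S' hS'
  -- Step C: all real roots
  have hneg_symm : ∀ l, (negPencilCoeff d S l).IsSymm := fun l => (hS l).smul _
  have hZ : rootCount d S ≤ 4 * 2 ^ E + 1 := by
    have h := h₁ K m d S
    have hp := hposB S hS
    have hn := hposB (negPencilCoeff d S) hneg_symm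
    omega
  have hZ' : rootCount d S ≤ 2 ^ (E + 3) := by
    have e8 : 2 ^ (E + 3) = 2 ^ E * 8 := by rw [pow_add]; norm_num
    have h1 : 1 ≤ 2 ^ E := Nat.one_le_two_pow
    omega
  -- Step D: arithmetic in the regime `m ≤ 2^{(L+c)^c}`, `K ≥ 2^{max L₀ 1}`
  have hK0 : K ≠ 0 := by
    have : 0 < 2 ^ max L₀ 1 := by positivity
    omega
  have hpow : 2 ^ L ≤ K := Nat.pow_log_le_self 2 hK0
  have hLge : max L₀ 1 ≤ L := Nat.le_log_of_pow_le one_lt_two hK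
  have hL1 : 1 ≤ L := le_of_max_le_right hLge
  have hLL : L₀ ≤ L := le_of_max_le_left hLge
  have hlogm : Nat.log 2 m ≤ (L + c) ^ c := by
    calc Nat.log 2 m ≤ Nat.log 2 (2 ^ ((L + c) ^ c)) := Nat.log_mono_right hm
      _ = (L + c) ^ c := Nat.log_pow (by norm_num) _
  set x := L + (c + 2) with hx
  have hx2 : 2 ≤ x := by omega
  have hxc : 1 ≤ x ^ c := Nat.one_le_pow _ _ (by omega)
  have h1 : Nat.log 2 m + 1 ≤ x ^ (c + 1) := by
    have hle : (L + c) ^ c ≤ x ^ c := Nat.pow_le_pow_left (by omega) c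
    calc Nat.log 2 m + 1 ≤ x ^ c + x ^ c := by omega
      _ = x ^ c * 2 := by ring
      _ ≤ x ^ c * x := Nat.mul_le_mul_left _ hx2
      _ = x ^ (c + 1) := by ring
  have h2 : L + 2 ≤ x := by omega
  have hE' : E ≤ a * x ^ (c + 2) := by
    calc E = a * (Nat.log 2 m + 1) * (L + 2) := rfl
      _ ≤ a * x ^ (c + 1) * x := Nat.mul_le_mul (Nat.mul_le_mul_left _ h1) h2
      _ = a * x ^ (c + 2) := by ring
  have hxc2 : 1 ≤ x ^ (c + 2) := Nat.one_le_pow _ _ (by omega)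
  have hE3 : (E + 3) * q ≤ K * L := by
    calc (E + 3) * q ≤ ((a + 3) * x ^ (c + 2)) * q := by
          apply Nat.mul_le_mul_right
          nlinarith
      _ = q * (a + 3) * (L + (c + 2)) ^ (c + 2) := by rw [hx]; ring
      _ ≤ 2 ^ L := hL₀ L hLL
      _ ≤ K := hpow
      _ = K * 1 := (mul_one K).symm
      _ ≤ K * L := Nat.mul_le_mul_left K hL1
  show rootCount d S ^ q ≤ 2 ^ (K * L)
  calc rootCount d S ^ q ≤ (2 ^ (E + 3)) ^ q := Nat.pow_le_pow_left hZ' q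
    _ = 2 ^ ((E + 3) * q) := (pow_mul 2 (E + 3) q).symm
    _ ≤ 2 ^ (K * L) := Nat.pow_le_pow_right (by norm_num) hE3

/-- **The line's composition**: the crux, by name, from the stubs. -/
theorem MatrixDescartes_of :
    Summit.ValiantsHypothesis.ValiantsHypothesis.Theses.LacunarySymmetroid.MatrixDescartes :=
  matrixDescartes_of_stubs stub_negRoots stub_perturb stub_split stub_bmd

end Summit.ValiantsHypothesis.ValiantsHypothesis.Cruxes.MatrixDescartes.SignSplit
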